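import Literature.Barriers.FinalStateConjecture.ExtremalHorizonSphereDecay
import Mathlib.MeasureTheory.Integral.IntegralEqImproper
import HarnessLib

/-!
# Barrier catalogue `FinalStateConjecture`: `L²` decay on the extremal horizon spheres from
# boundedness and integrated decay of the shell energies (Aretakis 2012, §15.2 from Thms. 1–2)
# (`Literature/Barriers/FinalStateConjecture/`, D-0021, D-0014; family `gr`)

Written from the proving seat of the named fact
`Literature.Barriers.FinalStateConjecture.Aretakis2012_pointwiseDecay` (Aretakis, JFA 263 (2012),
Thm. 5: pointwise decay of axisymmetric waves along the event horizon of extremal Kerr). The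
reductions of the catalogue bring that fact down to an `L²` statement on the horizon
spheres: `ExtremalHorizonSphereSobolev.lean` (Lemma 15.0.1, the spherical Sobolev inequality after
commutation with the Carter operator) and `ExtremalHorizonCarterOperator.lean` (the Carter operator
preserves Aretakis's class) reduce it to the decay of `∫₀^{2π}∫₀^π sin θ ψ(p_τ)² dθ dφ` on `S_τ`
for the class, and `ExtremalHorizonSphereDecay.lean` (`Kerr.horizonSphereSq_decay_of_shellEnergy`,
§15.2.2 with a layer of fixed width) reduces that to three statements about the shells
`{M ≤ r ≤ R₁} ⊂ Σ_τ`: (B) boundedness of `∫∫∫ sin θ (∂_ρψ)²`, (A) decay of the degenerate radial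
energy `∫∫∫ sin θ (r − M)²(∂_ρψ)²`, (F) decay of `∫∫ sin θ ψ²` on the sphere `{r = R₁}`.

**This file proves (A) and (F) — hence the `L²` decay on `S_τ` — from energy *boundedness* and
*integrated* local energy decay alone** (`Kerr.sphereL2Decay_of_shellEnergyStatements`), i.e. from
the shape of statements printed as Thm. 2 (uniform boundedness of the non-degenerate energy
`∫_{Σ_τ} J^N_μ[ψ]n^μ`, together with the spacetime bound
`∫_{r ≤ 23M/21} [ψ² + (Tψ)² + (r − M)(Yψ)² + |∇̸ψ|²] ≤ C ∫_{Σ₀} J^N[ψ]n`) and Thm. 1 (integrated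
local energy decay away from `𝓗⁺`, non-degenerate for `ψ²` and `(∂_{r*}ψ)²`) of the source, applied
to `ψ` and to `Tψ`. The source's own route through §15.2.1–15.2.2 is quantitative (rates `τ⁻¹`,
`τ^{-1/2}` from the decay of the degenerate energy, Thm. 3); the named fact is qualitative, and for a
qualitative conclusion the following soft mechanism suffices and is all that is used:

* `Kerr.eventually_le_of_integrableOn_of_lipschitz` (**the soft decay lemma**): a function
  `Q ≥ 0` on `[τ₀, ∞)` which is integrable and Lipschitz tends to `0`
  (`Q(τ)² ≤ 4L ∫_τ^∞ Q`);
* `Kerr.shellIntegral_sq_lipschitz`: for `g(τ, r, θ, φ)` with `τ`-derivative `dg` and a weight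
  `w ≥ 0`, the shell integral `τ ↦ ∫₀^{2π}∫₀^π∫_{R₁}^{R₂} w g² dr dθ dφ` is Lipschitz with constant
  `sup ∫∫∫ w g² + sup ∫∫∫ w dg²` (fundamental theorem of calculus in `τ`, `|2 g dg| ≤ g² + dg²`,
  Fubini on the box — `Kerr.shellIntegral_intervalIntegral_swap`); with `g = ∂_ρψ ∘ p`, `dg =
  T∂_ρψ ∘ p` this is "the energy of `Tψ` bounds the time derivative of the local energy of `ψ`";
* `Kerr.shellIntegral_sq_decay`: hence bounded + integrable-in-`τ` shell energies decay;
* `Kerr.sq_le_average_of_hasDerivAt` (**trace estimate**):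
  `g(a)² ≤ (2/(b − a))∫_a^b g² + 2(b − a)∫_a^b g'²`, controlling the sphere `{r = R₁}` by the
  shell `[R₁, R₂]` (the role of §15.2.1);
* `Kerr.sphereL2Decay_of_shellEnergyStatements` (**main**): for `Φ ∈ C²(E4)` and
  `M < R₁ < R₂`, bounds for `τ ≥ τ₀` on the shell integrals of `(∂_ρΦ)²`, `(T∂_ρΦ)²` over
  `[M, R₁]` and of `Φ²`, `(TΦ)²`, `(∂_ρΦ)²`, `(T∂_ρΦ)²` over `[R₁, R₂]`, plus integrability on
  `(τ₀, ∞)` of the shell integrals of `(r − M)²(∂_ρΦ)²` over `[M, R₁]` and of `Φ²`, `(∂_ρΦ)²` over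
  `[R₁, R₂]`, imply `∫₀^{2π}∫₀^π sin θ Φ(p_τ)² dθ dφ → 0` (`p_τ = Kerr.horizonPoint M τ`).

Here `p = Kerr.shellPoint M τ r θ φ = (τ, Y_M(r, θ, φ))` are the points of the Kerr–Schild leaves in
ingoing spheroidal coordinates, `∂_ρΦ = dΦ(p)(0, n̂(θ, φ))` (`Kerr.hasDerivAt_comp_shellPoint`),
`TΦ = dΦ(p) ∂_{t*}` (`Kerr.hasDerivAt_comp_shellPoint_tau`), and the measure `sin θ dr dθ dφ` is
comparable on bounded shells to the volume form `ρ² sin θ dr dθ dφ` of `Σ_τ`. Nothing is assumed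
beyond the displayed hypotheses (D-0026: no named facts); the energy statements themselves are the
business of the vector-field method of the source (Thms. 1–2) and are not proved here.

## References

* S. Aretakis, *Decay of axisymmetric solutions of the wave equation on extreme Kerr backgrounds*,
  J. Funct. Anal. 263 (2012) 2770–2831 (arXiv:1110.2006): §3, Thm. 1 (integrated local energy
  decay), Thm. 2 (uniform boundedness of non-degenerate energy), Thm. 3 (decay of degenerate
  energy), Thm. 5 (pointwise decay); §15.2.1 (decay away from `𝓗⁺`, first display), §15.2.2 (decay
  near `𝓗⁺`) (key `Aretakis2012`).
* S. Aretakis, *Horizon instability of extremal black holes*, Adv. Theor. Math. Phys. 19 (2015)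
  507–530 (arXiv:1206.6598), §5.2 and Thm. 3 (key `Aretakis2015`).
-/

noncomputable section

open Set Filter MeasureTheory intervalIntegral
open scoped Topology ContDiff

namespace Literature.Barriers.FinalStateConjecture.Kerr

open Literature.Geometry.Lorentzian

/-! ### The soft decay lemma: a nonnegative integrable Lipschitz function tends to zero -/

/-- **Soft decay lemma.** Let `Q ≥ 0` on `[τ₀, ∞)` be integrable on `(τ₀, ∞)` and Lipschitz there,
`|Q τ − Q τ'| ≤ L |τ − τ'|`. Then `Q τ → 0` as `τ → ∞`, in the form: for every `ε > 0` there is `τ₁`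
with `Q τ ≤ ε` for `τ ≥ τ₁`. (For `τ ≥ τ₀` one has `Q(τ)² ≤ 4L ∫_τ^∞ Q`: on `[τ, τ + Q(τ)/(2L)]`,
`Q ≥ Q(τ)/2`.) This is the elementary mechanism by which an *integrated* local energy decay
statement plus *boundedness* of a higher energy (the time derivative of the local energy) give
*qualitative* decay of the local energy. [folklore] -/
theorem eventually_le_of_integrableOn_of_lipschitz {Q : ℝ → ℝ} {τ₀ L : ℝ} (hL : 0 < L)
    (hQ0 : ∀ τ, τ₀ ≤ τ → 0 ≤ Q τ) (hint : IntegrableOn Q (Ioi τ₀))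
    (hlip : ∀ τ τ', τ₀ ≤ τ → τ₀ ≤ τ' → |Q τ - Q τ'| ≤ L * |τ - τ'|) :
    ∀ ε : ℝ, 0 < ε → ∃ τ₁ : ℝ, ∀ τ : ℝ, τ₁ ≤ τ → Q τ ≤ ε := by
  intro ε hε
  -- the total integral and the convergence of the partial integrals
  set T : ℝ := ∫ x in Ioi τ₀, Q x with hT
  have hconv : Tendsto (fun τ ↦ ∫ x in τ₀..τ, Q x) atTop (𝓝 T) :=
    intervalIntegral_tendsto_integral_Ioi τ₀ hint tendsto_id
  -- continuity of `Q` on `[τ₀, ∞)` (from the Lipschitz bound)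
  have hcont : ContinuousOn Q (Ici τ₀) := by
    intro τ hτ
    rw [Metric.continuousWithinAt_iff]
    intro δ hδ
    refine ⟨δ / L, by positivity, fun τ' hτ' hdist ↦ ?_⟩
    rw [Real.dist_eq] at hdist ⊢
    calc |Q τ' - Q τ| ≤ L * |τ' - τ| := hlip τ' τ hτ' hτ
      _ < L * (δ / L) := mul_lt_mul_of_pos_left hdist hL
      _ = δ := mul_div_cancel₀ δ hL.ne'
  -- partial integrals are bounded by the total
  have hpartial : ∀ b, τ₀ ≤ b → ∫ x in τ₀..b, Q x ≤ T := by
    intro b hb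
    rw [intervalIntegral.integral_of_le hb, hT]
    refine setIntegral_mono_set hint ?_ (Eventually.of_forall fun x hx ↦ ?_)
    · filter_upwards [ae_restrict_mem measurableSet_Ioi] with x hx
      exact hQ0 x (le_of_lt hx)
    · exact hx.1
  -- the key inequality: `Q(τ)² ≤ 4L (T − ∫_{τ₀}^τ Q)` for `τ ≥ τ₀`
  have hkey : ∀ τ, τ₀ ≤ τ → Q τ ^ 2 ≤ 4 * L * (T - ∫ x in τ₀..τ, Q x) := by
    intro τ hτ
    set δ : ℝ := Q τ / (2 * L) with hδ
    have hδ0 : 0 ≤ δ := div_nonneg (hQ0 τ hτ) (by positivity)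
    -- on `[τ, τ + δ]`, `Q ≥ Q τ / 2`
    have hlow : ∀ x ∈ Icc τ (τ + δ), Q τ / 2 ≤ Q x := by
      intro x hx
      have hxτ₀ : τ₀ ≤ x := hτ.trans hx.1
      have h := hlip x τ hxτ₀ hτ
      rw [abs_of_nonneg (by linarith [hx.1] : 0 ≤ x - τ)] at h
      have h2 : L * (x - τ) ≤ L * δ := mul_le_mul_of_nonneg_left (by linarith [hx.2]) hL.le
      have h3 : L * δ = Q τ / 2 := by rw [hδ]; field_simp
      have h4 : Q τ - Q x ≤ |Q x - Q τ| := by rw [abs_sub_comm]; exact le_abs_self _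
      linarith
    have hsub : Icc τ (τ + δ) ⊆ Ici τ₀ := fun x hx ↦ hτ.trans hx.1
    have hci : IntervalIntegrable Q volume τ (τ + δ) :=
      (hcont.mono hsub).intervalIntegrable_of_Icc (by linarith)
    have hI1 : δ * (Q τ / 2) ≤ ∫ x in τ..(τ + δ), Q x := by
      have h := intervalIntegral.integral_mono_on (by linarith : τ ≤ τ + δ)
        (intervalIntegrable_const) hci (fun x hx ↦ hlow x hx)
      rw [intervalIntegral.integral_const, smul_eq_mul] at h
      have : (τ + δ - τ) * (Q τ / 2) = δ * (Q τ / 2) := by ring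
      linarith
    -- and `∫_τ^{τ+δ} Q ≤ T − ∫_{τ₀}^τ Q`
    have hI2 : (∫ x in τ₀..τ, Q x) + ∫ x in τ..(τ + δ), Q x ≤ T := by
      have hadd : (∫ x in τ₀..τ, Q x) + ∫ x in τ..(τ + δ), Q x = ∫ x in τ₀..(τ + δ), Q x :=
        intervalIntegral.integral_add_adjacent_intervals
          ((hcont.mono (fun x hx ↦ (hx.1 : τ₀ ≤ x))).intervalIntegrable_of_Icc hτ) hci
      rw [hadd]
      exact hpartial _ (by linarith)
    have hsq : Q τ ^ 2 = 4 * L * (δ * (Q τ / 2)) := by rw [hδ]; field_simp; ring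
    rw [hsq]
    exact mul_le_mul_of_nonneg_left (by linarith) (by positivity)
  -- choose `τ₁` with the tail below `ε²/(4L)`
  have hev : ∀ᶠ τ in atTop, T - ε ^ 2 / (4 * L) < ∫ x in τ₀..τ, Q x :=
    hconv.eventually (lt_mem_nhds (by linarith [(by positivity : 0 < ε ^ 2 / (4 * L))]))
  obtain ⟨τ₁, hτ₁⟩ := (hev.and (eventually_ge_atTop τ₀)).exists_forall_of_atTop
  refine ⟨τ₁, fun τ hτ ↦ ?_⟩
  obtain ⟨h1, h2⟩ := hτ₁ τ hτ
  have h3 := hkey τ h2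
  have h4 : Q τ ^ 2 ≤ ε ^ 2 := by
    have : 4 * L * (T - ∫ x in τ₀..τ, Q x) ≤ 4 * L * (ε ^ 2 / (4 * L)) :=
      mul_le_mul_of_nonneg_left (by linarith) (by positivity)
    have h5 : 4 * L * (ε ^ 2 / (4 * L)) = ε ^ 2 := by field_simp
    linarith
  calc Q τ = Real.sqrt (Q τ ^ 2) := (Real.sqrt_sq (hQ0 τ h2)).symm
    _ ≤ Real.sqrt (ε ^ 2) := Real.sqrt_le_sqrt h4
    _ = ε := Real.sqrt_sq hε.le

/-! ### Iterated integrals over the shell box `[R₁, R₂] × [0, π] × [0, 2π]`: monotonicity and Fubini -/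

/-- The shell (triple iterated) integral of a function of `(r, θ, φ)`. [folklore] -/
def shellIntegral (R₁ R₂ : ℝ) (g : ℝ → ℝ → ℝ → ℝ) : ℝ :=
  ∫ φ in (0 : ℝ)..2 * Real.pi, ∫ θ in (0 : ℝ)..Real.pi, ∫ r in R₁..R₂, g r θ φ

/-- Unfolding lemma. [folklore] -/
theorem shellIntegral_def (R₁ R₂ : ℝ) (g : ℝ → ℝ → ℝ → ℝ) :
    shellIntegral R₁ R₂ g = ∫ φ in (0 : ℝ)..2 * Real.pi, ∫ θ in (0 : ℝ)..Real.pi, ∫ r in R₁..R₂, g r θ φ := rfl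

section Iterated

variable {R₁ R₂ : ℝ}

/-- Continuity of the inner integral `(θ, φ) ↦ ∫_{R₁}^{R₂} g` for a jointly continuous `g`. [folklore] -/
theorem continuous_inner_of_continuous {g : ℝ → ℝ → ℝ → ℝ}
    (hg : Continuous fun q : ℝ × ℝ × ℝ ↦ g q.1 q.2.1 q.2.2) :
    Continuous (Function.uncurry fun θ φ ↦ ∫ r in R₁..R₂, g r θ φ) := by
  have h : Continuous (Function.uncurry fun (q : ℝ × ℝ) r ↦ g r q.1 q.2) :=
    hg.comp (Continuous.prodMk continuous_snd (Continuous.prodMk (continuous_fst.comp continuous_fst)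
      (continuous_snd.comp continuous_fst)))
  exact intervalIntegral.continuous_parametric_intervalIntegral_of_continuous' h R₁ R₂

/-- **Monotonicity of the shell integral** for jointly continuous integrands compared on the box
(`R₁ ≤ R₂`). [folklore] -/
theorem shellIntegral_mono_on (hR : R₁ ≤ R₂) {f g : ℝ → ℝ → ℝ → ℝ}
    (hf : Continuous fun q : ℝ × ℝ × ℝ ↦ f q.1 q.2.1 q.2.2)
    (hg : Continuous fun q : ℝ × ℝ × ℝ ↦ g q.1 q.2.1 q.2.2)
    (h : ∀ r ∈ Icc R₁ R₂, ∀ θ ∈ Icc (0 : ℝ) Real.pi, ∀ φ ∈ Icc (0 : ℝ) (2 * Real.pi), f r θ φ ≤ g r θ φ) :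
    shellIntegral R₁ R₂ f ≤ shellIntegral R₁ R₂ g := by
  unfold shellIntegral
  refine sphereIntegral_mono_on (continuous_inner_of_continuous hf) (continuous_inner_of_continuous hg)
    fun θ hθ φ hφ ↦ ?_
  have hfr : Continuous fun r ↦ f r θ φ :=
    hf.comp (Continuous.prodMk continuous_id (Continuous.prodMk continuous_const continuous_const))
  have hgr : Continuous fun r ↦ g r θ φ :=
    hg.comp (Continuous.prodMk continuous_id (Continuous.prodMk continuous_const continuous_const))
  exact intervalIntegral.integral_mono_on hR (hfr.intervalIntegrable _ _) (hgr.intervalIntegrable _ _)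
    fun r hr ↦ h r hr θ hθ φ hφ

/-- Linearity of the shell integral: sums of jointly continuous integrands. [folklore] -/
theorem shellIntegral_add {f g : ℝ → ℝ → ℝ → ℝ}
    (hf : Continuous fun q : ℝ × ℝ × ℝ ↦ f q.1 q.2.1 q.2.2)
    (hg : Continuous fun q : ℝ × ℝ × ℝ ↦ g q.1 q.2.1 q.2.2) :
    shellIntegral R₁ R₂ (fun r θ φ ↦ f r θ φ + g r θ φ) = shellIntegral R₁ R₂ f + shellIntegral R₁ R₂ g := by
  unfold shellIntegral
  have hinner : ∀ θ φ, (∫ r in R₁..R₂, (f r θ φ + g r θ φ)) =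
      (∫ r in R₁..R₂, f r θ φ) + ∫ r in R₁..R₂, g r θ φ := by
    intro θ φ
    have hfr : Continuous fun r ↦ f r θ φ :=
      hf.comp (Continuous.prodMk continuous_id (Continuous.prodMk continuous_const continuous_const))
    have hgr : Continuous fun r ↦ g r θ φ :=
      hg.comp (Continuous.prodMk continuous_id (Continuous.prodMk continuous_const continuous_const))
    exact intervalIntegral.integral_add (hfr.intervalIntegrable _ _) (hgr.intervalIntegrable _ _)
  simp only [hinner]
  exact sphereIntegral_add (continuous_inner_of_continuous hf) (continuous_inner_of_continuous hg)

/-- Constants come out of the shell integral. [folklore] -/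
theorem shellIntegral_const_mul (c : ℝ) (f : ℝ → ℝ → ℝ → ℝ) :
    shellIntegral R₁ R₂ (fun r θ φ ↦ c * f r θ φ) = c * shellIntegral R₁ R₂ f := by
  unfold shellIntegral
  simp only [intervalIntegral.integral_const_mul]

/-- The shell integral of a nonnegative jointly continuous integrand is nonnegative (`R₁ ≤ R₂`).
[folklore] -/
theorem shellIntegral_nonneg (hR : R₁ ≤ R₂) {g : ℝ → ℝ → ℝ → ℝ}
    (hg : Continuous fun q : ℝ × ℝ × ℝ ↦ g q.1 q.2.1 q.2.2)
    (h : ∀ r ∈ Icc R₁ R₂, ∀ θ ∈ Icc (0 : ℝ) Real.pi, ∀ φ ∈ Icc (0 : ℝ) (2 * Real.pi), 0 ≤ g r θ φ) :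
    0 ≤ shellIntegral R₁ R₂ g := by
  have h0 : shellIntegral R₁ R₂ (fun _ _ _ ↦ (0 : ℝ)) = 0 := by simp [shellIntegral]
  rw [← h0]
  exact shellIntegral_mono_on hR continuous_const hg h

/-- **Fubini for the shell integral of a time integral** (continuous integrand on the compact box):
`∫∫∫ (∫_τ^{τ'} H ds) = ∫_τ^{τ'} ∫∫∫ H ds`. [folklore] -/
theorem shellIntegral_intervalIntegral_swap (hR : R₁ ≤ R₂) {τ τ' : ℝ} (hτ : τ ≤ τ')
    {H : ℝ → ℝ → ℝ → ℝ → ℝ} (hH : Continuous fun q : ℝ × ℝ × ℝ × ℝ ↦ H q.1 q.2.1 q.2.2.1 q.2.2.2) :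
    shellIntegral R₁ R₂ (fun r θ φ ↦ ∫ s in τ..τ', H s r θ φ) =
      ∫ s in τ..τ', shellIntegral R₁ R₂ (fun r θ φ ↦ H s r θ φ) := by
  have hπ : (0 : ℝ) ≤ Real.pi := Real.pi_pos.le
  have h2π : (0 : ℝ) ≤ 2 * Real.pi := by positivity
  unfold shellIntegral
  -- (1) swap `r` and `s` inside
  have h1 : ∀ θ φ, (∫ r in R₁..R₂, ∫ s in τ..τ', H s r θ φ) = ∫ s in τ..τ', ∫ r in R₁..R₂, H s r θ φ := by
    intro θ φ
    have hc : Continuous (Function.uncurry fun r s ↦ H s r θ φ) :=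
      hH.comp (Continuous.prodMk continuous_snd (Continuous.prodMk continuous_fst
        (Continuous.prodMk continuous_const continuous_const)))
    exact intervalIntegral_swap_of_continuous hc hR hτ
  simp only [h1]
  -- (2) swap `θ` and `s`
  have hIr : Continuous fun q : ℝ × ℝ × ℝ ↦ ∫ r in R₁..R₂, H q.1 r q.2.1 q.2.2 := by
    have h : Continuous (Function.uncurry fun (q : ℝ × ℝ × ℝ) r ↦ H q.1 r q.2.1 q.2.2) :=
      hH.comp (Continuous.prodMk (continuous_fst.comp continuous_fst) (Continuous.prodMk continuous_snd
        (Continuous.prodMk (continuous_fst.comp (continuous_snd.comp continuous_fst))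
          (continuous_snd.comp (continuous_snd.comp continuous_fst)))))
    exact intervalIntegral.continuous_parametric_intervalIntegral_of_continuous' h R₁ R₂
  have h2 : ∀ φ, (∫ θ in (0 : ℝ)..Real.pi, ∫ s in τ..τ', ∫ r in R₁..R₂, H s r θ φ) =
      ∫ s in τ..τ', ∫ θ in (0 : ℝ)..Real.pi, ∫ r in R₁..R₂, H s r θ φ := by
    intro φ
    have hc : Continuous (Function.uncurry fun θ s ↦ ∫ r in R₁..R₂, H s r θ φ) :=
      hIr.comp (Continuous.prodMk continuous_snd (Continuous.prodMk continuous_fst continuous_const))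
    exact intervalIntegral_swap_of_continuous hc hπ hτ
  simp only [h2]
  -- (3) swap `φ` and `s`
  have hIθ : Continuous fun q : ℝ × ℝ ↦ ∫ θ in (0 : ℝ)..Real.pi, ∫ r in R₁..R₂, H q.1 r θ q.2 := by
    have h : Continuous (Function.uncurry fun (q : ℝ × ℝ) θ ↦ ∫ r in R₁..R₂, H q.1 r θ q.2) :=
      hIr.comp (Continuous.prodMk (continuous_fst.comp continuous_fst) (Continuous.prodMk continuous_snd
        (continuous_snd.comp continuous_fst)))
    exact intervalIntegral.continuous_parametric_intervalIntegral_of_continuous' h 0 Real.pi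
  have hc : Continuous (Function.uncurry fun φ s ↦ ∫ θ in (0 : ℝ)..Real.pi, ∫ r in R₁..R₂, H s r θ φ) :=
    hIθ.comp (Continuous.prodMk continuous_snd continuous_fst)
  exact intervalIntegral_swap_of_continuous hc h2π hτ

end Iterated

/-! ### The trace estimate on an `r`-interval -/

/-- **Trace estimate**: if `g` has the continuous derivative `g'` on `[a, b]`, `a < b`, then
`g(a)² ≤ (2/(b − a)) ∫_a^b g² + 2(b − a) ∫_a^b g'²` (average over `r ∈ [a, b]` of
`g(a)² ≤ 2g(r)² + 2(r − a)∫_a^r g'²`). Used with `[a, b] = [R₁, R₂]` to control the sphere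
`{r = R₁}` by the shell `R₁ ≤ r ≤ R₂` (Aretakis 2012, §15.2.1). [folklore] -/
theorem sq_le_average_of_hasDerivAt {g g' : ℝ → ℝ} {a b : ℝ} (hab : a < b)
    (hg : ∀ x ∈ Icc a b, HasDerivAt g (g' x) x) (hg' : ContinuousOn g' (Icc a b)) :
    g a ^ 2 ≤ 2 / (b - a) * (∫ x in a..b, g x ^ 2) + 2 * (b - a) * ∫ x in a..b, g' x ^ 2 := by
  have hba : 0 < b - a := sub_pos.mpr hab
  have hgc : ContinuousOn g (Icc a b) := fun x hx ↦ (hg x hx).continuousAt.continuousWithinAt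
  have hI2 : 0 ≤ ∫ x in a..b, g' x ^ 2 := intervalIntegral.integral_nonneg hab.le fun x _ ↦ sq_nonneg _
  -- pointwise in `r ∈ [a, b]`
  have hpt : ∀ r ∈ Icc a b, g a ^ 2 ≤ 2 * g r ^ 2 + 2 * (b - a) * ∫ x in a..b, g' x ^ 2 := by
    intro r hr
    have hsub : Icc a r ⊆ Icc a b := Icc_subset_Icc le_rfl hr.2
    have e := sq_le_of_hasDerivAt hr.1 (fun x hx ↦ hg x (hsub hx)) (hg'.mono hsub)
    have hmono : ∫ x in a..r, g' x ^ 2 ≤ ∫ x in a..b, g' x ^ 2 :=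
      intervalIntegral.integral_mono_interval le_rfl hr.1 hr.2
        (Eventually.of_forall fun x ↦ sq_nonneg _) ((hg'.pow 2).intervalIntegrable_of_Icc hab.le)
    have hI1 : 0 ≤ ∫ x in a..r, g' x ^ 2 := intervalIntegral.integral_nonneg hr.1 fun x _ ↦ sq_nonneg _
    nlinarith [mul_le_mul (show r - a ≤ b - a by linarith [hr.2]) hmono hI1 hba.le, hr.1]
  -- integrate over `r ∈ [a, b]`
  set K : ℝ := 2 * (b - a) * ∫ x in a..b, g' x ^ 2 with hK
  have hi1 : IntervalIntegrable (fun r ↦ 2 * g r ^ 2) volume a b :=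
    ((hgc.pow 2).intervalIntegrable_of_Icc hab.le).const_mul 2
  have hi2 : IntervalIntegrable (fun _ ↦ K) volume a b := intervalIntegrable_const
  have hint : (∫ _r in a..b, g a ^ 2) ≤ ∫ r in a..b, (2 * g r ^ 2 + K) :=
    intervalIntegral.integral_mono_on hab.le intervalIntegrable_const (hi1.add hi2) fun r hr ↦ hpt r hr
  have e1 : (∫ _r in a..b, g a ^ 2) = (b - a) * g a ^ 2 := by
    rw [intervalIntegral.integral_const, smul_eq_mul]
  have e2 : (∫ r in a..b, (2 * g r ^ 2 + K)) = 2 * (∫ r in a..b, g r ^ 2) + (b - a) * K := by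
    rw [intervalIntegral.integral_add hi1 hi2, intervalIntegral.integral_const_mul,
      intervalIntegral.integral_const, smul_eq_mul]
  rw [e1, e2, hK] at hint
  rw [div_mul_eq_mul_div, div_add' _ _ _ hba.ne', le_div_iff₀ hba]
  nlinarith [hint]

/-! ### The shell points as functions of all four coordinates -/

/-- **The `t*`-lines of the shells**: `∂_τ p(τ, r, θ, φ) = ∂_{t*}` (`shellPoint M τ r θ φ =
τ ∂_{t*} + (0, Y_M(r, θ, φ))`). [cite: Aretakis2012, §2.5] -/
theorem hasDerivAt_shellPoint_tau (M τ r θ φ : ℝ) :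
    HasDerivAt (fun s ↦ shellPoint M s r θ φ) (E4.basisVector 0) τ := by
  have hfun : (fun s ↦ shellPoint M s r θ φ) =
      fun s ↦ s • E4.basisVector 0 + E4.spaceEmbed (Kerr.kerrStar M r θ φ) :=
    funext fun s ↦ E4.ofTimeSpace_eq_smul_add' s _
  rw [hfun]
  simpa using ((hasDerivAt_id τ).smul_const (E4.basisVector 0)).add_const
    (E4.spaceEmbed (Kerr.kerrStar M r θ φ))

/-- Joint continuity of `(τ, r, θ, φ) ↦ p(τ, r, θ, φ)`. [folklore] -/
theorem continuous_shellPoint₄ (M : ℝ) :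
    Continuous fun q : ℝ × ℝ × ℝ × ℝ ↦ shellPoint M q.1 q.2.1 q.2.2.1 q.2.2.2 := by
  simp only [shellPoint_eq_toLp]
  refine continuous_toLp_four ?_ ?_ ?_ ?_ <;> fun_prop

/-- **The `t*`-derivative along the shells** of `Φ ∘ p`: `∂_τ Φ(p) = dΦ(p) ∂_{t*}`.
[cite: Aretakis2012, §2.5] -/
theorem hasDerivAt_comp_shellPoint_tau {Φ : E4 → ℝ} {M τ r θ φ : ℝ}
    (hΦ : DifferentiableAt ℝ Φ (shellPoint M τ r θ φ)) :
    HasDerivAt (fun s ↦ Φ (shellPoint M s r θ φ))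
      (fderiv ℝ Φ (shellPoint M τ r θ φ) (E4.basisVector 0)) τ :=
  hΦ.hasFDerivAt.comp_hasDerivAt τ (hasDerivAt_shellPoint_tau M τ r θ φ)

/-- **The `t*`-derivative of a directional derivative along the shells**: for `Φ` of class `C²`,
`∂_τ [dΦ(p) v] = D²Φ(p)(∂_{t*}, v)`. [folklore] -/
theorem hasDerivAt_fderiv_comp_shellPoint_tau {Φ : E4 → ℝ} (hΦ : ContDiff ℝ 2 Φ) (v : E4)
    (M τ r θ φ : ℝ) :
    HasDerivAt (fun s ↦ fderiv ℝ Φ (shellPoint M s r θ φ) v)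
      (fderiv ℝ (fderiv ℝ Φ) (shellPoint M τ r θ φ) (E4.basisVector 0) v) τ := by
  have hd : DifferentiableAt ℝ (fderiv ℝ Φ) (shellPoint M τ r θ φ) :=
    ((hΦ.fderiv_right (m := 1) le_rfl).differentiable one_ne_zero).differentiableAt
  have h1 : HasDerivAt (fun s ↦ fderiv ℝ Φ (shellPoint M s r θ φ))
      (fderiv ℝ (fderiv ℝ Φ) (shellPoint M τ r θ φ) (E4.basisVector 0)) τ :=
    hd.hasFDerivAt.comp_hasDerivAt τ (hasDerivAt_shellPoint_tau M τ r θ φ)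
  simpa using h1.clm_apply (hasDerivAt_const τ v)

/-! ### Lipschitz continuity in `τ` of weighted shell integrals of squares, and their decay -/

section Lipschitz

variable {R₁ R₂ τ₀ C₁ C₂ : ℝ} {g dg : ℝ → ℝ → ℝ → ℝ → ℝ} {w : ℝ → ℝ → ℝ}

/-- **Lipschitz bound.** Let `g(τ, r, θ, φ)` have the `τ`-derivative `dg`, both jointly continuous,
and let `w(r, θ) ≥ 0` be a continuous weight on the box. If the shell integrals of `w g²` and
`w (dg)²` are bounded by `C₁`, `C₂` for `τ ≥ τ₀`, then `τ ↦ ∫∫∫ w g(τ)²` is `(C₁ + C₂)`-Lipschitz on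
`[τ₀, ∞)` (`|∂_τ (g²)| = |2 g dg| ≤ g² + dg²`, fundamental theorem of calculus, Fubini). The
mechanism of "boundedness of the energy of `Tψ` controls the time derivative of the local energy
of `ψ`". [folklore] -/
theorem shellIntegral_sq_lipschitz (hR : R₁ ≤ R₂)
    (hderiv : ∀ s r θ φ, HasDerivAt (fun s' ↦ g s' r θ φ) (dg s r θ φ) s)
    (hgc : Continuous fun q : ℝ × ℝ × ℝ × ℝ ↦ g q.1 q.2.1 q.2.2.1 q.2.2.2)
    (hdgc : Continuous fun q : ℝ × ℝ × ℝ × ℝ ↦ dg q.1 q.2.1 q.2.2.1 q.2.2.2)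
    (hw : Continuous (Function.uncurry w))
    (hw0 : ∀ r ∈ Icc R₁ R₂, ∀ θ ∈ Icc (0 : ℝ) Real.pi, 0 ≤ w r θ)
    (h₁ : ∀ s, τ₀ ≤ s → shellIntegral R₁ R₂ (fun r θ φ ↦ w r θ * g s r θ φ ^ 2) ≤ C₁)
    (h₂ : ∀ s, τ₀ ≤ s → shellIntegral R₁ R₂ (fun r θ φ ↦ w r θ * dg s r θ φ ^ 2) ≤ C₂) :
    ∀ τ τ', τ₀ ≤ τ → τ₀ ≤ τ' →
      |shellIntegral R₁ R₂ (fun r θ φ ↦ w r θ * g τ r θ φ ^ 2) -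
        shellIntegral R₁ R₂ (fun r θ φ ↦ w r θ * g τ' r θ φ ^ 2)| ≤ (C₁ + C₂) * |τ - τ'| := by
  -- continuity bookkeeping
  have hwc4 : Continuous fun q : ℝ × ℝ × ℝ × ℝ ↦ w q.2.1 q.2.2.1 :=
    hw.comp (Continuous.prodMk (continuous_fst.comp continuous_snd)
      (continuous_fst.comp (continuous_snd.comp continuous_snd)))
  have hwc3 : Continuous fun q : ℝ × ℝ × ℝ ↦ w q.1 q.2.1 :=
    hw.comp (Continuous.prodMk continuous_fst (continuous_fst.comp continuous_snd))
  have hg3 : ∀ s, Continuous fun q : ℝ × ℝ × ℝ ↦ g s q.1 q.2.1 q.2.2 := fun s ↦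
    hgc.comp (Continuous.prodMk continuous_const continuous_id)
  have hdg3 : ∀ s, Continuous fun q : ℝ × ℝ × ℝ ↦ dg s q.1 q.2.1 q.2.2 := fun s ↦
    hdgc.comp (Continuous.prodMk continuous_const continuous_id)
  -- the integrand of the time integral
  set H : ℝ → ℝ → ℝ → ℝ → ℝ := fun s r θ φ ↦ w r θ * (2 * g s r θ φ * dg s r θ φ) with hHdef
  have hHc : Continuous fun q : ℝ × ℝ × ℝ × ℝ ↦ H q.1 q.2.1 q.2.2.1 q.2.2.2 :=
    hwc4.mul ((continuous_const.mul hgc).mul hdgc)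
  -- the bound on the shell integral of `H` at each time `s ≥ τ₀`
  have hHbound : ∀ s, τ₀ ≤ s → |shellIntegral R₁ R₂ (fun r θ φ ↦ H s r θ φ)| ≤ C₁ + C₂ := by
    intro s hs
    have hsum := shellIntegral_add (R₁ := R₁) (R₂ := R₂) (f := fun r θ φ ↦ w r θ * g s r θ φ ^ 2)
      (g := fun r θ φ ↦ w r θ * dg s r θ φ ^ 2) (hwc3.mul ((hg3 s).pow 2)) (hwc3.mul ((hdg3 s).pow 2))
    have hup : shellIntegral R₁ R₂ (fun r θ φ ↦ H s r θ φ) ≤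
        shellIntegral R₁ R₂ (fun r θ φ ↦ w r θ * g s r θ φ ^ 2 + w r θ * dg s r θ φ ^ 2) :=
      shellIntegral_mono_on hR (hHc.comp (Continuous.prodMk continuous_const continuous_id))
        ((hwc3.mul ((hg3 s).pow 2)).add (hwc3.mul ((hdg3 s).pow 2))) fun r hr θ hθ φ _ ↦ by
          have h0 := hw0 r hr θ hθ
          simp only [hHdef]
          nlinarith [mul_nonneg h0 (sq_nonneg (g s r θ φ - dg s r θ φ))]
    have hlow : shellIntegral R₁ R₂ (fun r θ φ ↦ -(w r θ * g s r θ φ ^ 2 + w r θ * dg s r θ φ ^ 2)) ≤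
        shellIntegral R₁ R₂ (fun r θ φ ↦ H s r θ φ) :=
      shellIntegral_mono_on hR ((hwc3.mul ((hg3 s).pow 2)).add (hwc3.mul ((hdg3 s).pow 2))).neg
        (hHc.comp (Continuous.prodMk continuous_const continuous_id)) fun r hr θ hθ φ _ ↦ by
          have h0 := hw0 r hr θ hθ
          simp only [hHdef]
          nlinarith [mul_nonneg h0 (sq_nonneg (g s r θ φ + dg s r θ φ))]
    have hneg : shellIntegral R₁ R₂ (fun r θ φ ↦ -(w r θ * g s r θ φ ^ 2 + w r θ * dg s r θ φ ^ 2)) =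
        -shellIntegral R₁ R₂ (fun r θ φ ↦ w r θ * g s r θ φ ^ 2 + w r θ * dg s r θ φ ^ 2) := by
      have := shellIntegral_const_mul (R₁ := R₁) (R₂ := R₂) (-1)
        (fun r θ φ ↦ w r θ * g s r θ φ ^ 2 + w r θ * dg s r θ φ ^ 2)
      simpa using this
    rw [hneg, hsum] at hlow
    rw [hsum] at hup
    have := h₁ s hs
    have := h₂ s hs
    rw [abs_le]
    constructor <;> linarith
  -- the ordered case
  have key : ∀ τ τ', τ₀ ≤ τ → τ ≤ τ' →
      shellIntegral R₁ R₂ (fun r θ φ ↦ w r θ * g τ' r θ φ ^ 2) -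
        shellIntegral R₁ R₂ (fun r θ φ ↦ w r θ * g τ r θ φ ^ 2) =
        ∫ s in τ..τ', shellIntegral R₁ R₂ (fun r θ φ ↦ H s r θ φ) := by
    intro τ τ' _ hττ'
    -- fundamental theorem of calculus, pointwise
    have hftc : ∀ r θ φ, w r θ * g τ' r θ φ ^ 2 - w r θ * g τ r θ φ ^ 2 = ∫ s in τ..τ', H s r θ φ := by
      intro r θ φ
      have hd : ∀ s ∈ uIcc τ τ', HasDerivAt (fun s' ↦ w r θ * g s' r θ φ ^ 2) (H s r θ φ) s := by
        intro s _
        have h := ((hderiv s r θ φ).mul (hderiv s r θ φ)).const_mul (w r θ)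
        have hfun : (fun s' ↦ w r θ * g s' r θ φ ^ 2) = fun s' ↦ w r θ * (g s' r θ φ * g s' r θ φ) :=
          funext fun _ ↦ by ring
        rw [hfun]
        refine h.congr_deriv ?_
        simp only [hHdef]
        ring
      rw [intervalIntegral.integral_eq_sub_of_hasDerivAt hd
        ((hHc.comp (Continuous.prodMk continuous_id continuous_const :
          Continuous fun s : ℝ ↦ ((s, r, θ, φ) : ℝ × ℝ × ℝ × ℝ))).intervalIntegrable _ _)]
    rw [← shellIntegral_intervalIntegral_swap hR hττ' hHc]
    have hsub : shellIntegral R₁ R₂ (fun r θ φ ↦ w r θ * g τ' r θ φ ^ 2) -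
        shellIntegral R₁ R₂ (fun r θ φ ↦ w r θ * g τ r θ φ ^ 2) =
        shellIntegral R₁ R₂ (fun r θ φ ↦ w r θ * g τ' r θ φ ^ 2 + (-1) * (w r θ * g τ r θ φ ^ 2)) := by
      rw [shellIntegral_add (f := fun r θ φ ↦ w r θ * g τ' r θ φ ^ 2)
          (g := fun r θ φ ↦ (-1) * (w r θ * g τ r θ φ ^ 2)) (hwc3.mul ((hg3 τ').pow 2))
          (continuous_const.mul (hwc3.mul ((hg3 τ).pow 2))),
        shellIntegral_const_mul]
      ring
    rw [hsub]
    congr 1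
    funext r θ φ
    rw [← hftc]
    ring
  -- conclusion
  intro τ τ' hτ hτ'
  rcases le_total τ τ' with hle | hle
  · have hI := intervalIntegral.norm_integral_le_of_norm_le_const (a := τ) (b := τ') (C := C₁ + C₂)
      (f := fun s ↦ shellIntegral R₁ R₂ (fun r θ φ ↦ H s r θ φ)) fun s hs ↦ by
        rw [Real.norm_eq_abs]
        rw [uIoc_of_le hle] at hs
        exact hHbound s (hτ.trans hs.1.le)
    rw [Real.norm_eq_abs, ← key τ τ' hτ hle] at hI
    rw [abs_sub_comm]
    rwa [abs_sub_comm τ τ']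
  · have hI := intervalIntegral.norm_integral_le_of_norm_le_const (a := τ') (b := τ) (C := C₁ + C₂)
      (f := fun s ↦ shellIntegral R₁ R₂ (fun r θ φ ↦ H s r θ φ)) fun s hs ↦ by
        rw [Real.norm_eq_abs]
        rw [uIoc_of_le hle] at hs
        exact hHbound s (hτ'.trans hs.1.le)
    rw [Real.norm_eq_abs, ← key τ' τ hτ' hle] at hI
    exact hI

/-- **Qualitative decay of a weighted shell integral of squares** from (i) uniform bounds on the
shell integrals of `w g²` and `w (∂_τ g)²` for `τ ≥ τ₀` and (ii) integrability in `τ ∈ (τ₀, ∞)` of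
the shell integral of `w g²` (an *integrated local energy decay* statement): then
`∫∫∫ w g(τ)² → 0` as `τ → ∞`. [folklore] -/
theorem shellIntegral_sq_decay (hR : R₁ ≤ R₂)
    (hderiv : ∀ s r θ φ, HasDerivAt (fun s' ↦ g s' r θ φ) (dg s r θ φ) s)
    (hgc : Continuous fun q : ℝ × ℝ × ℝ × ℝ ↦ g q.1 q.2.1 q.2.2.1 q.2.2.2)
    (hdgc : Continuous fun q : ℝ × ℝ × ℝ × ℝ ↦ dg q.1 q.2.1 q.2.2.1 q.2.2.2)
    (hw : Continuous (Function.uncurry w))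
    (hw0 : ∀ r ∈ Icc R₁ R₂, ∀ θ ∈ Icc (0 : ℝ) Real.pi, 0 ≤ w r θ)
    (h₁ : ∀ s, τ₀ ≤ s → shellIntegral R₁ R₂ (fun r θ φ ↦ w r θ * g s r θ φ ^ 2) ≤ C₁)
    (h₂ : ∀ s, τ₀ ≤ s → shellIntegral R₁ R₂ (fun r θ φ ↦ w r θ * dg s r θ φ ^ 2) ≤ C₂)
    (hint : IntegrableOn (fun s ↦ shellIntegral R₁ R₂ (fun r θ φ ↦ w r θ * g s r θ φ ^ 2)) (Ioi τ₀)) :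
    ∀ ε : ℝ, 0 < ε → ∃ τ₁ : ℝ, ∀ τ : ℝ, τ₁ ≤ τ →
      shellIntegral R₁ R₂ (fun r θ φ ↦ w r θ * g τ r θ φ ^ 2) ≤ ε := by
  have hwc3 : Continuous fun q : ℝ × ℝ × ℝ ↦ w q.1 q.2.1 :=
    hw.comp (Continuous.prodMk continuous_fst (continuous_fst.comp continuous_snd))
  have hg3 : ∀ s, Continuous fun q : ℝ × ℝ × ℝ ↦ g s q.1 q.2.1 q.2.2 := fun s ↦
    hgc.comp (Continuous.prodMk continuous_const continuous_id)
  have hdg3 : ∀ s, Continuous fun q : ℝ × ℝ × ℝ ↦ dg s q.1 q.2.1 q.2.2 := fun s ↦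
    hdgc.comp (Continuous.prodMk continuous_const continuous_id)
  have hQ0 : ∀ s, 0 ≤ shellIntegral R₁ R₂ (fun r θ φ ↦ w r θ * g s r θ φ ^ 2) := fun s ↦
    shellIntegral_nonneg hR (hwc3.mul ((hg3 s).pow 2)) fun r hr θ hθ φ _ ↦
      mul_nonneg (hw0 r hr θ hθ) (sq_nonneg _)
  have hC₁ : 0 ≤ C₁ := (hQ0 τ₀).trans (h₁ τ₀ le_rfl)
  have hC₂ : 0 ≤ C₂ := (shellIntegral_nonneg hR (hwc3.mul ((hdg3 τ₀).pow 2)) fun r hr θ hθ φ _ ↦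
      mul_nonneg (hw0 r hr θ hθ) (sq_nonneg _)).trans (h₂ τ₀ le_rfl)
  have hlip := shellIntegral_sq_lipschitz hR hderiv hgc hdgc hw hw0 h₁ h₂
  refine eventually_le_of_integrableOn_of_lipschitz (L := C₁ + C₂ + 1) (by positivity)
    (fun τ _ ↦ hQ0 τ) hint fun τ τ' hτ hτ' ↦ (hlip τ τ' hτ hτ').trans ?_
  exact mul_le_mul_of_nonneg_right (by linarith) (abs_nonneg _)

end Lipschitz

/-! ### `L²` decay on the horizon spheres from boundedness and integrated decay of shell energies -/

section Main

variable {M R₁ R₂ τ₀ C : ℝ} {Φ : E4 → ℝ}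

/-- Continuity of `(τ, r, θ, φ) ↦ dΦ(p)(0, n̂(θ, φ))` for `Φ ∈ C¹`. [folklore] -/
theorem continuous_rhoDeriv_shellPoint₄ (hΦ : ContDiff ℝ 1 Φ) (M : ℝ) :
    Continuous fun q : ℝ × ℝ × ℝ × ℝ ↦
      fderiv ℝ Φ (shellPoint M q.1 q.2.1 q.2.2.1 q.2.2.2) (E4.spaceEmbed (sphRadial q.2.2.1 q.2.2.2)) :=
  ((hΦ.continuous_fderiv one_ne_zero).comp (continuous_shellPoint₄ M)).clm_apply
    (continuous_spaceEmbed_sphRadial.comp (continuous_snd.comp continuous_snd))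

/-- Continuity of `(τ, r, θ, φ) ↦ D²Φ(p)(∂_{t*}, (0, n̂(θ, φ)))` for `Φ ∈ C²`. [folklore] -/
theorem continuous_tauRhoDeriv_shellPoint₄ (hΦ : ContDiff ℝ 2 Φ) (M : ℝ) :
    Continuous fun q : ℝ × ℝ × ℝ × ℝ ↦
      fderiv ℝ (fderiv ℝ Φ) (shellPoint M q.1 q.2.1 q.2.2.1 q.2.2.2) (E4.basisVector 0)
        (E4.spaceEmbed (sphRadial q.2.2.1 q.2.2.2)) := by
  have h2c : Continuous (fderiv ℝ (fderiv ℝ Φ)) :=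
    (hΦ.fderiv_right (m := 1) le_rfl).continuous_fderiv one_ne_zero
  exact ((h2c.comp (continuous_shellPoint₄ M)).clm_apply continuous_const).clm_apply
    (continuous_spaceEmbed_sphRadial.comp (continuous_snd.comp continuous_snd))

/-- **`L²` decay on the horizon spheres `S_τ` from the energy statements of Aretakis 2012,
Thms. 1–2 (the `L²` input of §15.2).** Let `Φ ∈ C²(E4)`, `0 < M < R₁ < R₂`, and write
`p = p(τ, r, θ, φ)` (`shellPoint`), `∂_ρΦ = dΦ(p)(0, n̂)`, `TΦ = dΦ(p)∂_{t*}`,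
`T∂_ρΦ = D²Φ(p)(∂_{t*}, (0, n̂))`. Assume, for `τ ≥ τ₀` and one constant `C`:
* (bounds) the shell integrals `∫₀^{2π}∫₀^π∫ sin θ (·)² dr dθ dφ` of `∂_ρΦ`, `T∂_ρΦ` over
  `M ≤ r ≤ R₁` and of `Φ`, `TΦ`, `∂_ρΦ`, `T∂_ρΦ` over `R₁ ≤ r ≤ R₂` are `≤ C` — in the source:
  uniform boundedness of the non-degenerate energy `∫_{Σ_τ} J^N_μ[ψ] n^μ ∼ ∫ (Tψ)² + (Yψ)² + |∇̸ψ|²`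
  of `ψ` and of `Tψ`, Thm. 2 (with the zeroth-order term by the Hardy inequality of [Aretakis
  2011a, §6]);
* (integrated decay) `τ ↦ ∫∫∫_{M}^{R₁} sin θ (r − M)²(∂_ρΦ)²`, `τ ↦ ∫∫∫_{R₁}^{R₂} sin θ Φ²` and
  `τ ↦ ∫∫∫_{R₁}^{R₂} sin θ (∂_ρΦ)²` are integrable on `(τ₀, ∞)` — in the source: the integrated
  local energy decay statements, Thm. 2 near `𝓗⁺` (`∫_{r ≤ 23M/21} [ψ² + (Tψ)² + (r − M)(Yψ)² +
  |∇̸ψ|²] ≤ C ∫_{Σ₀} J^N[ψ]n`) and Thm. 1 away from `𝓗⁺` (`∫_{r ≥ r_e} [r^{-3-δ}ψ² +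
  r^{-1-δ}(∂_{r*}ψ)² + …] ≤ C ∫_{Σ₀} J^T[ψ]n`).
Then `∫₀^{2π}∫₀^π sin θ Φ(p_τ(θ, φ))² dθ dφ → 0` (`p_τ = horizonPoint M τ`). Proof: each of the
three shell quantities is nonnegative, integrable in `τ` and Lipschitz in `τ` (its `τ`-derivative
is controlled by the bounds for `Φ` and `TΦ`, `shellIntegral_sq_lipschitz`), hence tends to zero
(`eventually_le_of_integrableOn_of_lipschitz`); the sphere `{r = R₁}` is controlled by the shell
`[R₁, R₂]` (`sq_le_average_of_hasDerivAt`), and `horizonSphereSq_decay_of_shellEnergy` concludes.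
(The source argues quantitatively, with the decay *rates* of Thm. 3 and §15.2.1; the named fact
`Aretakis2012_pointwiseDecay` being qualitative, boundedness and integrated decay suffice.)
[cite: Aretakis2012, §15.2 and Thms. 1, 2, 5] -/
theorem sphereL2Decay_of_shellEnergyStatements (hR₁ : M < R₁) (hR₂ : R₁ < R₂)
    (hΦ : ContDiff ℝ 2 Φ)
    (hB₁ : ∀ τ : ℝ, τ₀ ≤ τ → shellIntegral M R₁ (fun r θ φ ↦ Real.sin θ *
        (fderiv ℝ Φ (shellPoint M τ r θ φ) (E4.spaceEmbed (sphRadial θ φ))) ^ 2) ≤ C)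
    (hB₂ : ∀ τ : ℝ, τ₀ ≤ τ → shellIntegral M R₁ (fun r θ φ ↦ Real.sin θ *
        (fderiv ℝ (fderiv ℝ Φ) (shellPoint M τ r θ φ) (E4.basisVector 0)
          (E4.spaceEmbed (sphRadial θ φ))) ^ 2) ≤ C)
    (hB₃ : ∀ τ : ℝ, τ₀ ≤ τ → shellIntegral R₁ R₂ (fun r θ φ ↦ Real.sin θ *
        Φ (shellPoint M τ r θ φ) ^ 2) ≤ C)
    (hB₄ : ∀ τ : ℝ, τ₀ ≤ τ → shellIntegral R₁ R₂ (fun r θ φ ↦ Real.sin θ *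
        (fderiv ℝ Φ (shellPoint M τ r θ φ) (E4.basisVector 0)) ^ 2) ≤ C)
    (hB₅ : ∀ τ : ℝ, τ₀ ≤ τ → shellIntegral R₁ R₂ (fun r θ φ ↦ Real.sin θ *
        (fderiv ℝ Φ (shellPoint M τ r θ φ) (E4.spaceEmbed (sphRadial θ φ))) ^ 2) ≤ C)
    (hB₆ : ∀ τ : ℝ, τ₀ ≤ τ → shellIntegral R₁ R₂ (fun r θ φ ↦ Real.sin θ *
        (fderiv ℝ (fderiv ℝ Φ) (shellPoint M τ r θ φ) (E4.basisVector 0)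
          (E4.spaceEmbed (sphRadial θ φ))) ^ 2) ≤ C)
    (hI₁ : IntegrableOn (fun τ ↦ shellIntegral M R₁ (fun r θ φ ↦ Real.sin θ * ((r - M) ^ 2 *
        (fderiv ℝ Φ (shellPoint M τ r θ φ) (E4.spaceEmbed (sphRadial θ φ))) ^ 2))) (Ioi τ₀))
    (hI₂ : IntegrableOn (fun τ ↦ shellIntegral R₁ R₂ (fun r θ φ ↦ Real.sin θ *
        Φ (shellPoint M τ r θ φ) ^ 2)) (Ioi τ₀))
    (hI₃ : IntegrableOn (fun τ ↦ shellIntegral R₁ R₂ (fun r θ φ ↦ Real.sin θ *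
        (fderiv ℝ Φ (shellPoint M τ r θ φ) (E4.spaceEmbed (sphRadial θ φ))) ^ 2)) (Ioi τ₀)) :
    ∀ ε : ℝ, 0 < ε → ∃ τ₁ : ℝ, ∀ τ : ℝ, τ₁ ≤ τ →
      (∫ φ in (0 : ℝ)..2 * Real.pi, ∫ θ in (0 : ℝ)..Real.pi,
        Real.sin θ * Φ (horizonPoint M τ θ φ) ^ 2) ≤ ε := by
  have hMR₁ : M ≤ R₁ := hR₁.le
  have hR₁₂ : R₁ ≤ R₂ := hR₂.le
  have h21 : 0 < R₂ - R₁ := sub_pos.mpr hR₂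
  have hΦ1 : ContDiff ℝ 1 Φ := hΦ.of_le one_le_two
  have hdiff : Differentiable ℝ Φ := hΦ1.differentiable one_ne_zero
  -- the four jointly continuous quantities `Φ(p)`, `TΦ(p)`, `∂_ρΦ(p)`, `T∂_ρΦ(p)`
  set g₀ : ℝ → ℝ → ℝ → ℝ → ℝ := fun s r θ φ ↦ Φ (shellPoint M s r θ φ) with hg₀
  set dg₀ : ℝ → ℝ → ℝ → ℝ → ℝ := fun s r θ φ ↦
    fderiv ℝ Φ (shellPoint M s r θ φ) (E4.basisVector 0) with hdg₀
  set g₁ : ℝ → ℝ → ℝ → ℝ → ℝ := fun s r θ φ ↦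
    fderiv ℝ Φ (shellPoint M s r θ φ) (E4.spaceEmbed (sphRadial θ φ)) with hg₁
  set dg₁ : ℝ → ℝ → ℝ → ℝ → ℝ := fun s r θ φ ↦
    fderiv ℝ (fderiv ℝ Φ) (shellPoint M s r θ φ) (E4.basisVector 0)
      (E4.spaceEmbed (sphRadial θ φ)) with hdg₁
  have hg₀c : Continuous fun q : ℝ × ℝ × ℝ × ℝ ↦ g₀ q.1 q.2.1 q.2.2.1 q.2.2.2 :=
    hΦ.continuous.comp (continuous_shellPoint₄ M)
  have hdg₀c : Continuous fun q : ℝ × ℝ × ℝ × ℝ ↦ dg₀ q.1 q.2.1 q.2.2.1 q.2.2.2 :=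
    ((hΦ1.continuous_fderiv one_ne_zero).comp (continuous_shellPoint₄ M)).clm_apply continuous_const
  have hg₁c : Continuous fun q : ℝ × ℝ × ℝ × ℝ ↦ g₁ q.1 q.2.1 q.2.2.1 q.2.2.2 :=
    continuous_rhoDeriv_shellPoint₄ hΦ1 M
  have hdg₁c : Continuous fun q : ℝ × ℝ × ℝ × ℝ ↦ dg₁ q.1 q.2.1 q.2.2.1 q.2.2.2 :=
    continuous_tauRhoDeriv_shellPoint₄ hΦ M
  have hder₀ : ∀ s r θ φ, HasDerivAt (fun s' ↦ g₀ s' r θ φ) (dg₀ s r θ φ) s := fun s r θ φ ↦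
    hasDerivAt_comp_shellPoint_tau (hdiff _)
  have hder₁ : ∀ s r θ φ, HasDerivAt (fun s' ↦ g₁ s' r θ φ) (dg₁ s r θ φ) s := fun s r θ φ ↦
    hasDerivAt_fderiv_comp_shellPoint_tau hΦ _ M s r θ φ
  -- the weights
  have hsinw : Continuous (Function.uncurry fun (_r θ : ℝ) ↦ Real.sin θ) :=
    Real.continuous_sin.comp continuous_snd
  have hsin0 : ∀ r ∈ Icc R₁ R₂, ∀ θ ∈ Icc (0 : ℝ) Real.pi, 0 ≤ (fun (_r θ : ℝ) ↦ Real.sin θ) r θ :=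
    fun r _ θ hθ ↦ Real.sin_nonneg_of_nonneg_of_le_pi hθ.1 hθ.2
  have hww : Continuous (Function.uncurry fun (r θ : ℝ) ↦ Real.sin θ * (r - M) ^ 2) :=
    (Real.continuous_sin.comp continuous_snd).mul ((continuous_fst.sub continuous_const).pow 2)
  have hww0 : ∀ r ∈ Icc M R₁, ∀ θ ∈ Icc (0 : ℝ) Real.pi,
      0 ≤ (fun (r θ : ℝ) ↦ Real.sin θ * (r - M) ^ 2) r θ :=
    fun r _ θ hθ ↦ mul_nonneg (Real.sin_nonneg_of_nonneg_of_le_pi hθ.1 hθ.2) (sq_nonneg _)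
  -- (A): decay of the degenerate radial energy in the layer `[M, R₁]`
  have hA : ∀ ε : ℝ, 0 < ε → ∃ τ₁ : ℝ, ∀ τ : ℝ, τ₁ ≤ τ →
      shellIntegral M R₁ (fun r θ φ ↦ (Real.sin θ * (r - M) ^ 2) * g₁ τ r θ φ ^ 2) ≤ ε := by
    have hw3 : Continuous fun q : ℝ × ℝ × ℝ ↦ Real.sin q.2.1 * (q.1 - M) ^ 2 :=
      (Real.continuous_sin.comp (continuous_fst.comp continuous_snd)).mul
        ((continuous_fst.sub continuous_const).pow 2)
    have hs3 : Continuous fun q : ℝ × ℝ × ℝ ↦ Real.sin q.2.1 :=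
      Real.continuous_sin.comp (continuous_fst.comp continuous_snd)
    have h3 : ∀ (G : ℝ → ℝ → ℝ → ℝ → ℝ), (Continuous fun q : ℝ × ℝ × ℝ × ℝ ↦ G q.1 q.2.1 q.2.2.1 q.2.2.2) →
        ∀ s, Continuous fun q : ℝ × ℝ × ℝ ↦ G s q.1 q.2.1 q.2.2 := fun G hG s ↦
      hG.comp (Continuous.prodMk continuous_const continuous_id)
    -- the bounds, from `hB₁`, `hB₂`
    have hbd : ∀ (G : ℝ → ℝ → ℝ → ℝ → ℝ), (Continuous fun q : ℝ × ℝ × ℝ × ℝ ↦ G q.1 q.2.1 q.2.2.1 q.2.2.2) →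
        ∀ s, shellIntegral M R₁ (fun r θ φ ↦ Real.sin θ * G s r θ φ ^ 2) ≤ C →
          shellIntegral M R₁ (fun r θ φ ↦ (Real.sin θ * (r - M) ^ 2) * G s r θ φ ^ 2) ≤
            (R₁ - M) ^ 2 * C := by
      intro G hG s hs
      have hmono : shellIntegral M R₁ (fun r θ φ ↦ (Real.sin θ * (r - M) ^ 2) * G s r θ φ ^ 2) ≤
          shellIntegral M R₁ (fun r θ φ ↦ (R₁ - M) ^ 2 * (Real.sin θ * G s r θ φ ^ 2)) :=
        shellIntegral_mono_on hMR₁ (hw3.mul ((h3 G hG s).pow 2))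
          (continuous_const.mul (hs3.mul ((h3 G hG s).pow 2))) fun r hr θ hθ φ _ ↦ by
            have hs0 : 0 ≤ Real.sin θ := Real.sin_nonneg_of_nonneg_of_le_pi hθ.1 hθ.2
            have h1 : (r - M) ^ 2 ≤ (R₁ - M) ^ 2 :=
              pow_le_pow_left₀ (by linarith [hr.1]) (by linarith [hr.2]) 2
            nlinarith [mul_le_mul_of_nonneg_left h1 (mul_nonneg hs0 (sq_nonneg (G s r θ φ)))]
      rw [shellIntegral_const_mul] at hmono
      exact hmono.trans (mul_le_mul_of_nonneg_left hs (sq_nonneg _))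
    have hint : IntegrableOn (fun s ↦ shellIntegral M R₁
        (fun r θ φ ↦ (Real.sin θ * (r - M) ^ 2) * g₁ s r θ φ ^ 2)) (Ioi τ₀) := by
      have hfun : (fun s ↦ shellIntegral M R₁ (fun r θ φ ↦ (Real.sin θ * (r - M) ^ 2) * g₁ s r θ φ ^ 2)) =
          fun τ ↦ shellIntegral M R₁ (fun r θ φ ↦ Real.sin θ * ((r - M) ^ 2 *
            (fderiv ℝ Φ (shellPoint M τ r θ φ) (E4.spaceEmbed (sphRadial θ φ))) ^ 2)) := by
        funext s
        congr 1
        funext r θ φ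
        simp only [hg₁]
        ring
      rw [hfun]
      exact hI₁
    exact shellIntegral_sq_decay (w := fun r θ ↦ Real.sin θ * (r - M) ^ 2) hMR₁ hder₁ hg₁c hdg₁c hww
      hww0 (fun s hs ↦ hbd g₁ hg₁c s (hB₁ s hs)) (fun s hs ↦ hbd dg₁ hdg₁c s (hB₂ s hs)) hint
  -- decay of the two shell quantities over `[R₁, R₂]`
  have hQ₃ : ∀ ε : ℝ, 0 < ε → ∃ τ₁ : ℝ, ∀ τ : ℝ, τ₁ ≤ τ →
      shellIntegral R₁ R₂ (fun r θ φ ↦ Real.sin θ * g₀ τ r θ φ ^ 2) ≤ ε :=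
    shellIntegral_sq_decay (w := fun _ θ ↦ Real.sin θ) hR₁₂ hder₀ hg₀c hdg₀c hsinw hsin0 hB₃ hB₄ hI₂
  have hQ₅ : ∀ ε : ℝ, 0 < ε → ∃ τ₁ : ℝ, ∀ τ : ℝ, τ₁ ≤ τ →
      shellIntegral R₁ R₂ (fun r θ φ ↦ Real.sin θ * g₁ τ r θ φ ^ 2) ≤ ε :=
    shellIntegral_sq_decay (w := fun _ θ ↦ Real.sin θ) hR₁₂ hder₁ hg₁c hdg₁c hsinw hsin0 hB₅ hB₆ hI₃
  -- (F): decay on the sphere `{r = R₁}` by the trace estimate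
  have hF : ∀ ε : ℝ, 0 < ε → ∃ τ₁ : ℝ, ∀ τ : ℝ, τ₁ ≤ τ →
      (∫ φ in (0 : ℝ)..2 * Real.pi, ∫ θ in (0 : ℝ)..Real.pi,
        Real.sin θ * Φ (shellPoint M τ R₁ θ φ) ^ 2) ≤ ε := by
    intro ε hε
    obtain ⟨τ₃, hτ₃⟩ := hQ₃ (ε * (R₂ - R₁) / 4) (by positivity)
    obtain ⟨τ₅, hτ₅⟩ := hQ₅ (ε / (4 * (R₂ - R₁))) (by positivity)
    refine ⟨max τ₃ τ₅, fun τ hτ ↦ ?_⟩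
    have h3 := hτ₃ τ (le_trans (le_max_left _ _) hτ)
    have h5 := hτ₅ τ (le_trans (le_max_right _ _) hτ)
    -- pointwise trace estimate along each `r`-line
    have hpt : ∀ θ φ, Φ (shellPoint M τ R₁ θ φ) ^ 2 ≤
        2 / (R₂ - R₁) * (∫ r in R₁..R₂, g₀ τ r θ φ ^ 2) + 2 * (R₂ - R₁) * ∫ r in R₁..R₂, g₁ τ r θ φ ^ 2 := by
      intro θ φ
      refine sq_le_average_of_hasDerivAt (g := fun r ↦ Φ (shellPoint M τ r θ φ)) (g' := fun r ↦ g₁ τ r θ φ)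
        hR₂ (fun r _ ↦ hasDerivAt_comp_shellPoint (hdiff _)) ?_
      exact (hg₁c.comp (Continuous.prodMk continuous_const
        (Continuous.prodMk continuous_id continuous_const) :
          Continuous fun r : ℝ ↦ ((τ, r, θ, φ) : ℝ × ℝ × ℝ × ℝ))).continuousOn
    -- the integrands on the sphere and their continuity
    set fF : ℝ → ℝ → ℝ := fun θ φ ↦ Real.sin θ * Φ (shellPoint M τ R₁ θ φ) ^ 2 with hfFdef
    set f₃ : ℝ → ℝ → ℝ := fun θ φ ↦ ∫ r in R₁..R₂, Real.sin θ * g₀ τ r θ φ ^ 2 with hf₃def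
    set f₅ : ℝ → ℝ → ℝ := fun θ φ ↦ ∫ r in R₁..R₂, Real.sin θ * g₁ τ r θ φ ^ 2 with hf₅def
    have hsinc : Continuous fun q : ℝ × ℝ ↦ Real.sin q.1 := Real.continuous_sin.comp continuous_fst
    have hfFc : Continuous (Function.uncurry fF) :=
      hsinc.mul ((hg₀c.comp (Continuous.prodMk continuous_const
        (Continuous.prodMk continuous_const continuous_id) :
          Continuous fun q : ℝ × ℝ ↦ ((τ, R₁, q) : ℝ × ℝ × ℝ × ℝ))).pow 2)
    have hs3 : Continuous fun q : ℝ × ℝ × ℝ ↦ Real.sin q.2.1 :=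
      Real.continuous_sin.comp (continuous_fst.comp continuous_snd)
    have hg₀3 : Continuous fun q : ℝ × ℝ × ℝ ↦ g₀ τ q.1 q.2.1 q.2.2 :=
      hg₀c.comp (Continuous.prodMk continuous_const continuous_id)
    have hg₁3 : Continuous fun q : ℝ × ℝ × ℝ ↦ g₁ τ q.1 q.2.1 q.2.2 :=
      hg₁c.comp (Continuous.prodMk continuous_const continuous_id)
    have hf₃c : Continuous (Function.uncurry f₃) := continuous_inner_of_continuous (hs3.mul (hg₀3.pow 2))
    have hf₅c : Continuous (Function.uncurry f₅) := continuous_inner_of_continuous (hs3.mul (hg₁3.pow 2))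
    have hf₃c' : Continuous (Function.uncurry fun θ φ ↦ 2 / (R₂ - R₁) * f₃ θ φ) :=
      continuous_const.mul hf₃c
    have hf₅c' : Continuous (Function.uncurry fun θ φ ↦ 2 * (R₂ - R₁) * f₅ θ φ) :=
      continuous_const.mul hf₅c
    have hg : Continuous (Function.uncurry fun θ φ ↦
        2 / (R₂ - R₁) * f₃ θ φ + 2 * (R₂ - R₁) * f₅ θ φ) := hf₃c'.add hf₅c'
    have hmono := sphereIntegral_mono_on (f := fF)
      (g := fun θ φ ↦ 2 / (R₂ - R₁) * f₃ θ φ + 2 * (R₂ - R₁) * f₅ θ φ) hfFc hg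
      (fun θ hθ φ _ ↦ by
        have hs : 0 ≤ Real.sin θ := Real.sin_nonneg_of_nonneg_of_le_pi hθ.1 hθ.2
        have h1 := mul_le_mul_of_nonneg_left (hpt θ φ) hs
        have e₃ : f₃ θ φ = Real.sin θ * ∫ r in R₁..R₂, g₀ τ r θ φ ^ 2 := by
          show (∫ r in R₁..R₂, Real.sin θ * g₀ τ r θ φ ^ 2) = _
          exact intervalIntegral.integral_const_mul _ _
        have e₅ : f₅ θ φ = Real.sin θ * ∫ r in R₁..R₂, g₁ τ r θ φ ^ 2 := by
          show (∫ r in R₁..R₂, Real.sin θ * g₁ τ r θ φ ^ 2) = _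
          exact intervalIntegral.integral_const_mul _ _
        have eF : fF θ φ = Real.sin θ * Φ (shellPoint M τ R₁ θ φ) ^ 2 := rfl
        rw [e₃, e₅, eF]
        nlinarith [h1])
    have hsum : (∫ φ in (0 : ℝ)..2 * Real.pi, ∫ θ in (0 : ℝ)..Real.pi,
        (2 / (R₂ - R₁) * f₃ θ φ + 2 * (R₂ - R₁) * f₅ θ φ)) =
        2 / (R₂ - R₁) * shellIntegral R₁ R₂ (fun r θ φ ↦ Real.sin θ * g₀ τ r θ φ ^ 2) +
          2 * (R₂ - R₁) * shellIntegral R₁ R₂ (fun r θ φ ↦ Real.sin θ * g₁ τ r θ φ ^ 2) := by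
      rw [sphereIntegral_add hf₃c' hf₅c', sphereIntegral_const_mul, sphereIntegral_const_mul]
      rfl
    rw [hsum] at hmono
    have e1 : 2 / (R₂ - R₁) * shellIntegral R₁ R₂ (fun r θ φ ↦ Real.sin θ * g₀ τ r θ φ ^ 2) ≤ ε / 2 := by
      calc 2 / (R₂ - R₁) * shellIntegral R₁ R₂ (fun r θ φ ↦ Real.sin θ * g₀ τ r θ φ ^ 2)
          ≤ 2 / (R₂ - R₁) * (ε * (R₂ - R₁) / 4) := mul_le_mul_of_nonneg_left h3 (by positivity)
        _ = ε / 2 := by field_simp; ring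
    have e2 : 2 * (R₂ - R₁) * shellIntegral R₁ R₂ (fun r θ φ ↦ Real.sin θ * g₁ τ r θ φ ^ 2) ≤ ε / 2 := by
      calc 2 * (R₂ - R₁) * shellIntegral R₁ R₂ (fun r θ φ ↦ Real.sin θ * g₁ τ r θ φ ^ 2)
          ≤ 2 * (R₂ - R₁) * (ε / (4 * (R₂ - R₁))) := mul_le_mul_of_nonneg_left h5 (by positivity)
        _ = ε / 2 := by field_simp; ring
    show (∫ φ in (0 : ℝ)..2 * Real.pi, ∫ θ in (0 : ℝ)..Real.pi, fF θ φ) ≤ ε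
    linarith
  -- (A) and (B) in the shape of `horizonSphereSq_decay_of_shellEnergy`, and the conclusion
  have hA' : ∀ ε : ℝ, 0 < ε → ∃ τ₁ : ℝ, ∀ τ : ℝ, τ₁ ≤ τ →
      (∫ φ in (0 : ℝ)..2 * Real.pi, ∫ θ in (0 : ℝ)..Real.pi, ∫ r in M..R₁,
        Real.sin θ * ((r - M) ^ 2 *
          (fderiv ℝ Φ (shellPoint M τ r θ φ) (E4.spaceEmbed (sphRadial θ φ))) ^ 2)) ≤ ε := by
    intro ε hε
    obtain ⟨τ₁, hτ₁⟩ := hA ε hε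
    refine ⟨τ₁, fun τ hτ ↦ ?_⟩
    have h := hτ₁ τ hτ
    have hfun : (fun r θ φ ↦ (Real.sin θ * (r - M) ^ 2) * g₁ τ r θ φ ^ 2) =
        fun r θ φ ↦ Real.sin θ * ((r - M) ^ 2 *
          (fderiv ℝ Φ (shellPoint M τ r θ φ) (E4.spaceEmbed (sphRadial θ φ))) ^ 2) := by
      funext r θ φ
      simp only [hg₁]
      ring
    rw [hfun] at h
    exact h
  exact horizonSphereSq_decay_of_shellEnergy hR₁ hΦ1 (fun τ hτ ↦ hB₁ τ hτ) hA' hF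

end Main

end Literature.Barriers.FinalStateConjecture.Kerr

end
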